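/-
Copyright (c) 2026 the pub-hodgecm-mathlib formalisation cell (harness21).  Prover seat hodgecm-mathlib-R90-C10-p01 (g2) (R90-TF SLAB, section S1 «Ch. 12 local»,
surplus hand on S1's last socket A2′ `stub_R90_122_keysThmTwo_ramifiedCharOne` = the K2E3 leaf (U4f-χ₁-ram-one), RULING R-S1-4), Track B «K2-LIT» ∕ h413 =
`stmt-HodgeConjecture-24833`, line `K2_E3_EllipticInputs`, unit U4 «Keys», PART «U4Keys» socket :182 (U4f-χ₁-ram-one-pos)
`sig_K2E3KeysThmTwoContractingRamifiedCharOnePosDepth` (programme A_pos^{=} of K2E3-p37 (g0), memo `K2/K2E3-p37/g0/CENSUS-U4f-PosDepth.K2E3-p37-g0.md` §6–§10):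
brick §10 (a) «COVERING LEMMA» — every intermediate lower unipotent carries a depth witness (families X ∪ Z).  REPORT-FIRST 2026-09-04.
-/
import Summits.HodgeConjecture.HodgeConjecture.Theorems.K2E3LevelNDepthWitnessX   -- ★ p862033 (K2E3-p37): family X `exists_familyX_witness`; brings ★ p861978 family Z `exists_familyZ_witness`, ★ p861919, ★ p861613, ★ p861548 (`J_n` test), ★ BigCell (`v_mul_v_le_of_rel`)
import HarnessLib

/-!
# K2 ∕ E3 «EllipticInputs», unit U4 «Keys» — (U4f-χ₁-ram-one-pos), programme A_pos^{=} brick §10 (a): THE COVER OF THE INTERMEDIATE CELLS BY THE TWO WITNESS FAMILIES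
# «`ū = ū(x, z) ∈ U(σ, Φ₃)(K)`, `|z| < 1`, `ū ∉ J_{m+1}`, `σc = c`, `|c| ≤ |ϖ|ᵐ`, `|2| = 1`, `m ≥ 1` ⟹ `∃ u ∈ N`, `ū⁻¹ u ū ∈ J_{m+1}`, `(ū⁻¹ u ū)₀₀ = (1 + c)(1 + ε)`, `|ε| ≤ |ϖ|^{m+1}`»
# [Roche1998 §4; Casselman1995 §6.3; Rogawski1990 §1.10; Serre1979 Ch. II §1]

Cell hodgecm-mathlib, Track B «K2-LIT», crux item H413 = stmt-HodgeConjecture-24833 (route `HCCMUnconditional`, no route verbs); target BY NAME the OPEN tier-0 leaf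
`…K2E3EllipticInputs.U4Keys.sig_K2E3KeysThmTwoContractingRamifiedCharOnePosDepth` (U4Keys ED. 8 :182), design D-I «vanishing functional» at POSITIVE depth, sub-case A_pos^{=}
(cond(`χ₁|_{F^×}`) = cond `χ₁` = `m + 1`, `|2|_w = 1`).  Author R90-C10-p01 (g2) (S1 surplus hand dealt «=» by R90-C10-plan 2026-09-04T16:34:35Z; the S1 junction socket A2′
`R90_S1_NonsplitLocalPacketsA.stub_R90_122_keysThmTwo_ramifiedCharOne` IS this leaf's parent (U4f-χ₁-ram-one)).  `--supports stmt-HodgeConjecture-24833 --as helper`;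
THEOREMS ONLY; MODEL level (`U(σ, Φ₃)(K)`, `K` any `ℤᵐ⁰`-valued field, `σ` an isometric involution).  NOT THE PAYER of :182 — item (a) of K2E3-p37's «REMAINING» list (§10);
items (b) CM dress and (c) the (v)-asm assembly `not_reducible_of_posDepth_of_normChar_ne_one_eq` stay open.

THE POINT.  The cell-family engine ★ p861573 (`K2E3BranchAContradictionCells`) wants, for every representative `r` of the family `R = N̄ ∖ J_n` (`n = m + 1`), a witness
`b₀ ∈ J_n` with `r b₀ r⁻¹ ∈ P` and `θ(b₀) ≠ (χδ^{½})(r b₀ r⁻¹)` (letter `hwit`).  On the big cell `|z| ≥ 1` this is ★ p861613; on the INTERMEDIATE cells — `ū = ū(x, z)` with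
`|z| < 1`, `ū ∉ J_n` — K2E3-p37 built the witness `b₀ = ū⁻¹ u ū`, `u ∈ N`, in two regimes: ★ p861978 FAMILY Z («`z` dominant»: `|x|² ≤ |z||ϖ|`, `|ϖ|ᵐ ≤ |z| ≤ |ϖ|`, `|x| ≤ |ϖ|`,
`σc = c`) and ★ p862033 FAMILY X («`x` dominant»: `|ϖ|ᵐ ≤ |x| ≤ |ϖ|`, `|z| ≤ |x||ϖ|`, `|z||ϖ|^{m+1} ≤ (|x||ϖ|)²`, any `c`), both concluding
`∃ u ∈ N, ū⁻¹uū ∈ J_{m+1} ∧ ∃ ε, |ε| ≤ |ϖ|^{m+1} ∧ (ū⁻¹uū)₀₀ = (1 + c)(1 + ε)`.  THIS FILE proves that the two regimes COVER every intermediate cell (memo §10 (a),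
«CHECK the case split is exhaustive»), so the assembly gets ONE lemma with the engine's natural hypotheses `|z| < 1` and `ū ∉ J_{m+1}`:
(1) `|x|² ≤ |z| < 1` (★ `v_mul_v_le_of_rel`) forces `|x| < 1`, i.e. `|x| ≤ |ϖ|` (DISCRETENESS `v_le_of_lt_one`), and `|z| ≤ |ϖ|`;
(2) `ū` is then integral, so by the level test ★ p861548 `ū ∉ J_{m+1}` reads `¬(|x| ≤ |ϖ|^{m+1} ∧ |z| ≤ |ϖ|^{m+1})` (entries `(2,0) = z`, `(2,1) = x`, `(1,0) = −σx`);
(3) if `|z| ≤ |x||ϖ|`: were `|x| < |ϖ|ᵐ` then `|x| ≤ |ϖ|^{m+1}` (`v_le_pow_succ_of_lt_pow`) and `|z| ≤ |ϖ|^{m+2}`, contradicting (2); so `|ϖ|ᵐ ≤ |x|`, and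
    `|z||ϖ|^{m+1} ≤ |x||ϖ|·|ϖ|ᵐ·|ϖ| ≤ (|x||ϖ|)²` — FAMILY X;
(4) else `|x||ϖ| < |z|`, so `|x| ≤ |z|` (`v_le_of_mul_v_lt`), `|x|² ≤ |z||ϖ|`; were `|z| < |ϖ|ᵐ` then `|x| ≤ |z| ≤ |ϖ|^{m+1}`, contradicting (2); so `|ϖ|ᵐ ≤ |z|` — FAMILY Z.
* §1 discreteness in `ℤᵐ⁰`: `v_le_pow_succ_of_lt_pow`, `v_le_of_lt_one`, `v_le_of_mul_v_lt`.
* §2 `not_le_and_le_of_not_mem` (step (2)), **`exists_depth_witness_of_not_mem`** (the cover).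
HONEST LABEL: HC_CM is proved only modulo the 7 printed citations (2 remaining named inputs: hLiu418 = stmt-HodgeConjecture-24832, h413 = stmt-HodgeConjecture-24833)
until rung 0 closes; count-neutral — this file does NOT pay the leaf; no printed citation is discharged.

## References
* [Roche1998] A. Roche, *Types and Hecke algebras for principal series representations of split reductive p-adic groups*, Ann. Sci. ÉNS (4) 31 (1998), §4.
* [Casselman1995] W. Casselman, *Introduction to the theory of admissible representations of `p`-adic reductive groups* (1995), §6.3.
* [Rogawski1990] J. D. Rogawski, *Automorphic Representations of Unitary Groups in Three Variables*, Ann. of Math. Stud. 123 (1990), §1.9–§1.10 pp. 8–9.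
* [Serre1979] J.-P. Serre, *Local Fields*, GTM 67 (1979), Ch. II §1.
-/

set_option autoImplicit false
-- the mandated namespace repeats the single-problem summit's segment (`HodgeConjecture.HodgeConjecture`)
set_option linter.dupNamespace false

noncomputable section

open Matrix Literature.NumberTheory.Automorphic Literature.NumberTheory.Automorphic.UnitaryGroup
open scoped Matrix MatrixGroups WithZero Pointwise

namespace Summit.HodgeConjecture.HodgeConjecture.Cruxes.H413.K2E3LevelNDepthWitnessCover

open Summit.HodgeConjecture.HodgeConjecture.Cruxes.H413

variable {K : Type*} [Field K] [Valued K ℤᵐ⁰] [ValuativeRel K] [(Valued.v : Valuation K ℤᵐ⁰).Compatible]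
  (σ : K →+* K) {ϖ : K} {J : Matrix (Fin 3) (Fin 3) K} (hJ : J = (StdForm.antidiagonal 3).over K)
  (hσ : ∀ a, σ (σ a) = a) (hvσ : ∀ a, Valued.v (σ a) = Valued.v a) (hvϖ : Valued.v ϖ = WithZero.exp (-1 : ℤ))
  {m : ℕ} (gn : GL (Fin 3) K) (hgn : (gn : Matrix (Fin 3) (Fin 3) K) = Matrix.diagonal ![(1 : K), 1, ϖ ^ (m + 1)])

/-! ## §1 Discreteness of `|·|` in `ℤᵐ⁰` -/

omit [ValuativeRel K] [(Valued.v : Valuation K ℤᵐ⁰).Compatible] in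
include hvϖ in
/-- **DISCRETENESS**: `|a| < |ϖ|ⁿ ⟹ |a| ≤ |ϖ|ⁿ⁺¹` (`|a| = |ϖ|ᵉ` with `e > n` an integer). [cite: Serre1979, Ch. II §1] -/
theorem v_le_pow_succ_of_lt_pow {a : K} {n : ℕ} (h : Valued.v a < Valued.v ϖ ^ n) :
    Valued.v a ≤ Valued.v ϖ ^ (n + 1) := by
  rcases eq_or_ne a 0 with rfl | ha
  · rw [map_zero]; exact zero_le
  have hva : Valued.v a ≠ 0 := (Valuation.ne_zero_iff _).2 ha
  rw [← map_pow, CartanUnique.v_uniformizer_pow hvϖ, ← WithZero.exp_log hva, WithZero.exp_lt_exp] at h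
  rw [← map_pow, CartanUnique.v_uniformizer_pow hvϖ, ← WithZero.exp_log hva, WithZero.exp_le_exp]
  push_cast
  omega

omit [ValuativeRel K] [(Valued.v : Valuation K ℤᵐ⁰).Compatible] in
include hvϖ in
/-- `|a| < 1 ⟹ |a| ≤ |ϖ|`. [cite: Serre1979, Ch. II §1] -/
theorem v_le_of_lt_one {a : K} (h : Valued.v a < 1) : Valued.v a ≤ Valued.v ϖ := by
  have h' := v_le_pow_succ_of_lt_pow hvϖ (n := 0) (by rwa [pow_zero])
  rwa [zero_add, pow_one] at h'

omit [ValuativeRel K] [(Valued.v : Valuation K ℤᵐ⁰).Compatible] in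
include hvϖ in
/-- **DISCRETENESS**: `|a|·|ϖ| < |b| ⟹ |a| ≤ |b|`. [cite: Serre1979, Ch. II §1] -/
theorem v_le_of_mul_v_lt {a b : K} (h : Valued.v a * Valued.v ϖ < Valued.v b) : Valued.v a ≤ Valued.v b := by
  rcases eq_or_ne a 0 with rfl | ha
  · rw [map_zero]; exact zero_le
  rcases eq_or_ne b 0 with rfl | hb
  · rw [map_zero] at h; exact absurd h not_lt_zero
  have hva : Valued.v a ≠ 0 := (Valuation.ne_zero_iff _).2 ha
  have hvb : Valued.v b ≠ 0 := (Valuation.ne_zero_iff _).2 hb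
  rw [hvϖ, ← WithZero.exp_log hva, ← WithZero.exp_log hvb, ← WithZero.exp_add, WithZero.exp_lt_exp] at h
  rw [← WithZero.exp_log hva, ← WithZero.exp_log hvb, WithZero.exp_le_exp]
  omega

/-! ## §2 The cover -/

include hJ hvσ hvϖ hgn in
/-- **`ū(x, z) ∉ J_{m+1}` ON THE ENTRIES**: for an INTEGRAL lower unipotent `ū(x, z)` (`|x|, |z| ≤ 1`), non-membership in `J_{m+1} = K₀ ⊓ g K₀ g⁻¹` means
`¬(|x| ≤ |ϖ|^{m+1} ∧ |z| ≤ |ϖ|^{m+1})` — the level test ★ `mem_glInt_inf_conj_glInt_pow_iff` (p861548) read on `(2,0) = z`, `(2,1) = x`, `(1,0) = −σx`.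
[cite: Roche1998, §4] [cite: Casselman1995, §6.3] -/
theorem not_le_and_le_of_not_mem {nb : ↥(unitaryGroupOfForm σ J)} {x z : K}
    (hnb : ((nb : GL (Fin 3) K) : Matrix (Fin 3) (Fin 3) K) = !![1, 0, 0; -σ x, 1, 0; z, x, 1])
    (hx1 : Valued.v x ≤ 1) (hz1 : Valued.v z ≤ 1)
    (hoff : nb ∉ (glInt 3 K).subgroupOf (unitaryGroupOfForm σ J) ⊓ ((glInt 3 K).map (MulAut.conj gn).toMonoidHom).subgroupOf (unitaryGroupOfForm σ J)) :
    ¬ (Valued.v x ≤ Valued.v ϖ ^ (m + 1) ∧ Valued.v z ≤ Valued.v ϖ ^ (m + 1)) := by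
  have hnbK : (nb : GL (Fin 3) K) ∈ glInt 3 K := mem_glInt_of_coe_eq_lower σ hJ hvσ hnb hx1 hz1
  rintro ⟨hxn, hzn⟩
  apply hoff
  rw [K2E3IwahoriLevelNFactorisation.mem_glInt_inf_conj_glInt_pow_iff σ hJ hvσ hvϖ gn hgn]
  refine ⟨(mem_glInt_subgroupOf_iff σ hJ hvσ _).1 (Subgroup.mem_subgroupOf.2 hnbK), ?_, ?_, ?_⟩
  · rw [hnb]; simpa using hzn
  · rw [hnb]; simpa using hxn
  · rw [hnb]; simpa [Valuation.map_neg, hvσ] using hxn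

include hJ hσ hvσ hvϖ hgn in
/-- **DEPTH WITNESS ON EVERY INTERMEDIATE CELL (families X ∪ Z).**  `ū ∈ U(σ, Φ₃)` with matrix `ū(x, z)` (`z + σz + xσx = 0`) OFF the big cell (`|z| < 1`) and OFF
the level-`(m+1)` Iwahori `J_{m+1} = K₀ ⊓ g K₀ g⁻¹` (`g = diag(1,1,ϖ^{m+1})`); `c` with `σc = c`, `|c| ≤ |ϖ|ᵐ`; `|2| = 1`; `m ≥ 1`.  Then some `u ∈ N` has `ū⁻¹ u ū ∈ J_{m+1}`
and `(ū⁻¹ u ū)₀₀ = (1 + c)(1 + ε)` with `|ε| ≤ |ϖ|^{m+1}`.  Case `|z| ≤ |x||ϖ|`: FAMILY X ★ p862033 (`|ϖ|ᵐ ≤ |x|` and p37's `hz2` are DERIVED from `ū ∉ J_{m+1}`);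
case `|x||ϖ| < |z|`: `|x| ≤ |z|` by discreteness, FAMILY Z ★ p861978.  This is the letter `hwit` of the cell-family engine ★ p861573 on the intermediate cells in
sub-case A_pos^{=} (cond(`χ₁|_{F^×}`) = `m + 1` supplies a `σ`-fixed `c ∈ 𝔭ᵐ` with `χ₁(1 + c) ≠ 1`; `θ(ū⁻¹uū) = χ₁(1 + c)` via ★ p861880 `theta_mul_pow`, while
`(χδ^{½})(u) = 1`). [cite: Roche1998, §4] [cite: Casselman1995, §6.3] [cite: Rogawski1990, §1.10 p. 9] [cite: Serre1979, Ch. II §1] -/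
theorem exists_depth_witness_of_not_mem (hm : 1 ≤ m) {nb : ↥(unitaryGroupOfForm σ J)} {x z c : K}
    (hnb : ((nb : GL (Fin 3) K) : Matrix (Fin 3) (Fin 3) K) = !![1, 0, 0; -σ x, 1, 0; z, x, 1]) (hrel : z + σ z + x * σ x = 0)
    (hz : Valued.v z < 1)
    (hoff : nb ∉ (glInt 3 K).subgroupOf (unitaryGroupOfForm σ J) ⊓ ((glInt 3 K).map (MulAut.conj gn).toMonoidHom).subgroupOf (unitaryGroupOfForm σ J))
    (hσc : σ c = c) (hc : Valued.v c ≤ Valued.v ϖ ^ m) (h2 : Valued.v (2 : K) = 1) :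
    ∃ u : ↥(unitaryGroupOfForm σ J), u ∈ unipotentU σ J ∧
      nb⁻¹ * u * nb ∈ (glInt 3 K).subgroupOf (unitaryGroupOfForm σ J) ⊓ ((glInt 3 K).map (MulAut.conj gn).toMonoidHom).subgroupOf (unitaryGroupOfForm σ J) ∧
      ∃ ε : K, Valued.v ε ≤ Valued.v ϖ ^ (m + 1) ∧
        (((nb⁻¹ * u * nb : ↥(unitaryGroupOfForm σ J)) : GL (Fin 3) K) : Matrix (Fin 3) (Fin 3) K) 0 0 = (1 + c) * (1 + ε) := by
  have hvϖ1 : Valued.v ϖ ≤ 1 := by rw [hvϖ, ← WithZero.exp_zero, WithZero.exp_le_exp]; norm_num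
  -- (1) `|z| ≤ |ϖ|`, `|x|² ≤ |z| < 1`, `|x| ≤ |ϖ|`
  have hz1 : Valued.v z ≤ Valued.v ϖ := v_le_of_lt_one hvϖ hz
  have hxx : Valued.v x * Valued.v x ≤ Valued.v z := v_mul_v_le_of_rel σ hvσ hrel
  have hxlt : Valued.v x < 1 := by
    by_contra h
    rw [not_lt] at h
    exact absurd (lt_of_le_of_lt ((one_le_mul h h).trans hxx) hz) (lt_irrefl 1)
  have hx : Valued.v x ≤ Valued.v ϖ := v_le_of_lt_one hvϖ hxlt
  -- (2) `ū ∉ J_{m+1}` on the entries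
  have hoff' := not_le_and_le_of_not_mem σ hJ hvσ hvϖ gn hgn hnb (hx.trans hvϖ1) (hz1.trans hvϖ1) hoff
  by_cases hzx : Valued.v z ≤ Valued.v x * Valued.v ϖ
  · -- (3) family X
    have hxm : Valued.v ϖ ^ m ≤ Valued.v x := by
      by_contra h
      rw [not_le] at h
      have hxn := v_le_pow_succ_of_lt_pow hvϖ h
      exact hoff' ⟨hxn, hzx.trans ((mul_le_mul' hxn hvϖ1).trans_eq (mul_one _))⟩
    have hz2 : Valued.v z * Valued.v ϖ ^ (m + 1) ≤ (Valued.v x * Valued.v ϖ) ^ 2 :=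
      calc Valued.v z * Valued.v ϖ ^ (m + 1) ≤ (Valued.v x * Valued.v ϖ) * Valued.v ϖ ^ (m + 1) := mul_le_mul' hzx le_rfl
        _ = (Valued.v x * Valued.v ϖ) * (Valued.v ϖ ^ m * Valued.v ϖ) := by rw [pow_succ]
        _ ≤ (Valued.v x * Valued.v ϖ) * (Valued.v x * Valued.v ϖ) := mul_le_mul' le_rfl (mul_le_mul' hxm le_rfl)
        _ = (Valued.v x * Valued.v ϖ) ^ 2 := (sq _).symm
    exact K2E3LevelNDepthWitnessX.exists_familyX_witness σ hJ hσ hvσ hvϖ gn hgn hm hnb hrel hx hxm hzx hz2 hc h2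
  · -- (4) family Z
    rw [not_le] at hzx
    have hxz' : Valued.v x ≤ Valued.v z := v_le_of_mul_v_lt hvϖ hzx
    have hzm : Valued.v ϖ ^ m ≤ Valued.v z := by
      by_contra h
      rw [not_le] at h
      have hzn := v_le_pow_succ_of_lt_pow hvϖ h
      exact hoff' ⟨hxz'.trans hzn, hzn⟩
    exact K2E3LevelNDepthWitnessZ.exists_familyZ_witness σ hJ hσ hvσ hvϖ gn hgn hm hnb hrel hx hz1 hzm
      (mul_le_mul' hxz' hx) hσc hc h2

end Summit.HodgeConjecture.HodgeConjecture.Cruxes.H413.K2E3LevelNDepthWitnessCover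

end
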